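import Mathlib

/-!
# §6 numerics for the line «sfm-bl» (PROOF-SFM-BL §6, constants)

FRONTIER F-N1c; nothing here bears on P vs NP.

Definition-free arithmetic lemmas that turn Proposition 7 (`SfmBlProp7.sum_trace_pow_le_explicit`), Lemma 10 /
`SfmBlSpotBudget.sum_hatE_le` and the block splitting (`SfmBlBlockSplit.sum_blocks_le`) into the budget
inequalities of the §6 assembly.  CONSTANTS (crude-log version, all side conditions below are proved here):
`L = 2^60`, `γ' = √(100·L·log₂ L) = √(6000·2^60)`, `γ_sp = 60·γ'`, `ρ_R = 100·γ_sp·(log₂(L/γ_sp)+1) ≤ L/20`.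
* `sfmBl_gamma'_sq_ge` : `144·L·ln L ≤ γ'²` (needs `ln 2 < 0.6944…`; Mathlib's `Real.log_two_lt_d9`);
* `sfmBl_gammasp_le_L`, `sfmBl_two_le_gammasp`, `sfmBl_rho_le` : `γ_sp ≤ L`, `2 ≤ γ_sp`, `ρ_R ≤ L/20`;
* `hatWeight_le` : `Σ_{k∈(t,K]} Ldeg^{2(k-1)}·k·e^{−γ²k/(12L)} ≤ 2·L^{−(9(t+1)+2)}` (the `ê`-side weight, cf.
  `SfmBlProp7.badWeight_le`), and `hatWeight_range_le` (the `k = 0` term vanishes);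
* `four_N_sq_pow_le` : `4N²L^{2k} ≤ L^{10(t₀+1)+2}` once `N ≤ 2^b` and `2k + 2b ≤ 10(t₀+1)` (choice of `t₀`);
* `twenty_N_pow_le` : `20·N·ρ^{2j} ≤ (√2·ρ)^{2j}` once `20N ≤ 2^j` (choice of the walk length `ℓ = 2j`);
* `remainder_budget_le` : `N·√2ρ/2 ≤ 0.32·m` from `ρ ≤ L/20`, `N ≤ 2n+1+6m/L`, `L·n ≤ m`, `1 ≤ n`.
-/

namespace Summit.PneNP.PneNP.Theorems.SfmBl

open Finset BigOperators

/-! ### The constants `L = 2^60`, `γ' = √(6000·2^60)`, `γ_sp = 60γ'` -/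

/-- `γ'² = 6000·2^60 = 100·L·log₂ L`. -/
theorem sfmBl_gamma'_sq : (Real.sqrt (6000 * 2 ^ 60)) ^ 2 = 6000 * (2 : ℝ) ^ 60 :=
  Real.sq_sqrt (by positivity)

/-- The hypothesis `hγ'L` of `sum_trace_pow_le_explicit`: `144·L·ln L ≤ γ'²` for `L = 2^60`. -/
theorem sfmBl_gamma'_sq_ge :
    144 * (2 : ℝ) ^ 60 * Real.log ((2 : ℝ) ^ 60) ≤ (Real.sqrt (6000 * 2 ^ 60)) ^ 2 := by
  rw [sfmBl_gamma'_sq, Real.log_pow]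
  have h := Real.log_two_lt_d9
  push_cast
  nlinarith [h, show (0 : ℝ) < 2 ^ 60 by positivity]

/-- `1 ≤ γ'` (crudely). -/
theorem sfmBl_one_le_gamma' : (1 : ℝ) ≤ Real.sqrt (6000 * 2 ^ 60) := by
  rw [show (1 : ℝ) = Real.sqrt 1 by simp]
  exact Real.sqrt_le_sqrt (by norm_num)

/-- `2 ≤ γ_sp = 60γ'`. -/
theorem sfmBl_two_le_gammasp : (2 : ℝ) ≤ 60 * Real.sqrt (6000 * 2 ^ 60) := by
  have := sfmBl_one_le_gamma'; linarith

/-- `γ' ≤ γ_sp`. -/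
theorem sfmBl_gamma'_le_gammasp : Real.sqrt (6000 * 2 ^ 60) ≤ 60 * Real.sqrt (6000 * 2 ^ 60) := by
  have := sfmBl_one_le_gamma'; linarith

/-- `γ_sp ≤ L / 120000` (the numerical heart: `(7.2·10^6)²·6000 ≤ 2^60`). -/
theorem sfmBl_gammasp_le : 60 * Real.sqrt (6000 * 2 ^ 60) ≤ (2 : ℝ) ^ 60 / 120000 := by
  have h : Real.sqrt (6000 * 2 ^ 60) ≤ (2 : ℝ) ^ 60 / 7200000 := by
    rw [Real.sqrt_le_left (by positivity)]
    nlinarith [show (0 : ℝ) < 2 ^ 60 by positivity]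
  linarith

/-- The hypothesis `hγspL` of `sum_trace_pow_le_explicit`: `γ_sp ≤ L`. -/
theorem sfmBl_gammasp_le_L : 60 * Real.sqrt (6000 * 2 ^ 60) ≤ (2 : ℝ) ^ 60 := by
  exact sfmBl_gammasp_le.trans (div_le_self (by positivity) (by norm_num))

/-- `ρ_R = 100·γ_sp·(log₂(L/γ_sp) + 1) ≤ L/20` (via `log₂(L/γ_sp) ≤ log₂(L/2) = 59`). -/
theorem sfmBl_rho_le :
    100 * (60 * Real.sqrt (6000 * 2 ^ 60))
        * (Real.logb 2 ((2 : ℝ) ^ 60 / (60 * Real.sqrt (6000 * 2 ^ 60))) + 1)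
      ≤ (2 : ℝ) ^ 60 / 20 := by
  set g : ℝ := 60 * Real.sqrt (6000 * 2 ^ 60) with hg
  have hg2 : 2 ≤ g := sfmBl_two_le_gammasp
  have hg0 : 0 < g := by linarith
  have hlog : Real.logb 2 ((2 : ℝ) ^ 60 / g) ≤ 59 := by
    calc Real.logb 2 ((2 : ℝ) ^ 60 / g) ≤ Real.logb 2 ((2 : ℝ) ^ 60 / 2) :=
          Real.logb_le_logb_of_le (by norm_num) (by positivity)
            (div_le_div_of_nonneg_left (by positivity) (by norm_num) hg2)
      _ = 59 := by
          rw [show (2 : ℝ) ^ 60 / 2 = 2 ^ (59 : ℕ) by norm_num, Real.logb_pow,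
            Real.logb_self_eq_one (by norm_num)]
          norm_num
  have hγ := sfmBl_gammasp_le
  rw [← hg] at hγ
  calc 100 * g * (Real.logb 2 ((2 : ℝ) ^ 60 / g) + 1) ≤ 100 * g * 60 := by
        refine mul_le_mul_of_nonneg_left ?_ (by positivity); linarith
    _ ≤ (2 : ℝ) ^ 60 / 20 := by linarith

/-! ### Size-summed weights -/

/-- `ê`-SIDE WEIGHT: with `γ² ≥ 144·L·ln L`, `Ldeg ≤ L`, `L ≥ 2`:
`Σ_{k∈(t,K]} Ldeg^{2(k-1)}·k·e^{−γ²k/(12L)} ≤ 2·L^{−(9(t+1)+2)}` (use with `t = 0`: `≤ 2·L^{−11}`). -/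
theorem hatWeight_le {L : ℝ} (hL : 2 ≤ L) {Ldeg : ℕ} (hLdeg : (Ldeg : ℝ) ≤ L) {γ : ℝ}
    (hγ : 144 * L * Real.log L ≤ γ ^ 2) (t K : ℕ) :
    ∑ k ∈ Finset.Ioc t K, (Ldeg : ℝ) ^ (2 * (k - 1)) * ((k : ℝ) * Real.exp (-(γ ^ 2 * k / (12 * L))))
      ≤ 2 * (L ^ (9 * (t + 1) + 2))⁻¹ := by
  have hL0 : 0 < L := by linarith
  have hL1 : 1 ≤ L := by linarith
  have hterm : ∀ k ∈ Finset.Ioc t K,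
      (Ldeg : ℝ) ^ (2 * (k - 1)) * ((k : ℝ) * Real.exp (-(γ ^ 2 * k / (12 * L))))
        ≤ (L ^ (9 * k + 2))⁻¹ := by
    intro k hk
    have hk1 : 1 ≤ k := by have := (Finset.mem_Ioc.1 hk).1; omega
    have h1 : (Ldeg : ℝ) ^ (2 * (k - 1)) ≤ L ^ (2 * (k - 1)) :=
      pow_le_pow_left₀ (Nat.cast_nonneg _) hLdeg _
    have h2 : Real.exp (-(γ ^ 2 * k / (12 * L))) ≤ (L ^ (12 * k))⁻¹ := by
      have hkey : (12 * k : ℝ) * Real.log L ≤ γ ^ 2 * k / (12 * L) := by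
        rw [le_div_iff₀ (by positivity)]
        have hk0 : (0 : ℝ) ≤ k := Nat.cast_nonneg k
        have := mul_le_mul_of_nonneg_right hγ hk0
        calc (12 * k : ℝ) * Real.log L * (12 * L) = 144 * L * Real.log L * k := by ring
          _ ≤ γ ^ 2 * k := this
      calc Real.exp (-(γ ^ 2 * k / (12 * L)))
          ≤ Real.exp (-((12 * k : ℝ) * Real.log L)) := Real.exp_le_exp.2 (neg_le_neg hkey)
        _ = (L ^ (12 * k))⁻¹ := by
            rw [Real.exp_neg, show (12 * k : ℝ) * Real.log L = ((12 * k : ℕ) : ℝ) * Real.log L by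
              push_cast; ring, Real.exp_nat_mul, Real.exp_log hL0]
    have h3 : (k : ℝ) ≤ L ^ k := by
      calc (k : ℝ) ≤ ((2 ^ k : ℕ) : ℝ) := by exact_mod_cast (Nat.lt_two_pow_self).le
        _ = (2 : ℝ) ^ k := by push_cast; ring
        _ ≤ L ^ k := pow_le_pow_left₀ (by norm_num) hL k
    have hprod : (L : ℝ) ^ (2 * (k - 1)) * (L ^ k * (L ^ (12 * k))⁻¹) = (L ^ (9 * k + 2))⁻¹ := by
      have hsplit : (L : ℝ) ^ (12 * k) = L ^ (2 * (k - 1)) * L ^ k * L ^ (9 * k + 2) := by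
        rw [← pow_add, ← pow_add]; congr 1; omega
      rw [hsplit, mul_inv, mul_inv]
      field_simp
    calc (Ldeg : ℝ) ^ (2 * (k - 1)) * ((k : ℝ) * Real.exp (-(γ ^ 2 * k / (12 * L))))
        ≤ L ^ (2 * (k - 1)) * (L ^ k * (L ^ (12 * k))⁻¹) :=
          mul_le_mul h1 (mul_le_mul h3 h2 (by positivity) (by positivity)) (by positivity)
            (by positivity)
      _ = (L ^ (9 * k + 2))⁻¹ := hprod
  -- geometric sum with ratio `x = L^{-9} ≤ 2^{-9}`
  set x : ℝ := (L ^ 9)⁻¹ with hx_def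
  have hx0 : 0 ≤ x := by positivity
  have hL9 : (2 : ℝ) ≤ L ^ 9 := by
    calc (2 : ℝ) ≤ 2 ^ 9 := by norm_num
      _ ≤ L ^ 9 := pow_le_pow_left₀ (by norm_num) hL 9
  have hx1 : x ≤ 1 / 2 := by
    rw [hx_def, inv_le_comm₀ (by positivity) (by norm_num)]
    simpa using hL9
  have hIoc : Finset.Ioc t K = Finset.Ico (t + 1) (K + 1) := by
    ext k; simp only [Finset.mem_Ioc, Finset.mem_Ico]; omega
  have hpow : ∀ k : ℕ, (L ^ (9 * k + 2))⁻¹ = (L ^ 2)⁻¹ * x ^ k := by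
    intro k; rw [hx_def, inv_pow, ← pow_mul, pow_add, mul_inv, mul_comm]
  calc ∑ k ∈ Finset.Ioc t K, (Ldeg : ℝ) ^ (2 * (k - 1)) * ((k : ℝ) * Real.exp (-(γ ^ 2 * k / (12 * L))))
      ≤ ∑ k ∈ Finset.Ioc t K, (L ^ (9 * k + 2))⁻¹ := Finset.sum_le_sum hterm
    _ = (L ^ 2)⁻¹ * ∑ k ∈ Finset.Ico (t + 1) (K + 1), x ^ k := by
        rw [hIoc, Finset.mul_sum]
        exact Finset.sum_congr rfl fun k _ => hpow k
    _ ≤ (L ^ 2)⁻¹ * (x ^ (t + 1) / (1 - x)) :=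
        mul_le_mul_of_nonneg_left (geom_sum_Ico_le_of_lt_one hx0 (by linarith)) (by positivity)
    _ ≤ (L ^ 2)⁻¹ * (2 * x ^ (t + 1)) := by
        refine mul_le_mul_of_nonneg_left ?_ (by positivity)
        rw [div_le_iff₀ (by linarith)]
        nlinarith [pow_nonneg hx0 (t + 1)]
    _ = 2 * (L ^ (9 * (t + 1) + 2))⁻¹ := by
        rw [hpow (t + 1)]; ring

/-- The same weight summed over `k ∈ range (K+1)` (the shape produced by `SfmBlSpotBudget.sum_le_sum_by_size`):
the `k = 0` term vanishes, so the sum is `≤ 2·L^{−11}`. -/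
theorem hatWeight_range_le {L : ℝ} (hL : 2 ≤ L) {Ldeg : ℕ} (hLdeg : (Ldeg : ℝ) ≤ L) {γ : ℝ}
    (hγ : 144 * L * Real.log L ≤ γ ^ 2) (K : ℕ) :
    ∑ k ∈ Finset.range (K + 1), (Ldeg : ℝ) ^ (2 * (k - 1)) * ((k : ℝ) * Real.exp (-(γ ^ 2 * k / (12 * L))))
      ≤ 2 * (L ^ 11)⁻¹ := by
  have hsplit : Finset.range (K + 1) = insert 0 (Finset.Ioc 0 K) := by
    ext k; simp only [Finset.mem_range, Finset.mem_insert, Finset.mem_Ioc]; omega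
  rw [hsplit, Finset.sum_insert (by simp)]
  simp only [Nat.cast_zero, zero_mul, mul_zero, zero_add]
  simpa using hatWeight_le hL hLdeg hγ 0 K

/-! ### Choice of `t₀` and of the walk length -/

/-- CHOICE OF `t₀`: if `N ≤ 2^b` and `2k + 2b ≤ 10(t₀+1)` then `4N²L^{2k} ≤ L^{10(t₀+1)+2}` (`L ≥ 2`), so the
second term of `sum_trace_pow_le_explicit` is `≤ 2^m`. -/
theorem four_N_sq_pow_le {L N : ℝ} (hL : 2 ≤ L) (hN : 0 ≤ N) {b k t₀ : ℕ} (hNb : N ≤ 2 ^ b)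
    (ht : 2 * k + 2 * b ≤ 10 * (t₀ + 1)) :
    4 * N ^ 2 * L ^ (2 * k) ≤ L ^ (10 * (t₀ + 1) + 2) := by
  have hL1 : 1 ≤ L := by linarith
  have h1 : 4 * N ^ 2 ≤ L ^ (2 * b + 2) := by
    calc 4 * N ^ 2 = (2 * N) ^ 2 := by ring
      _ ≤ (2 ^ (b + 1)) ^ 2 := by
          apply pow_le_pow_left₀ (by positivity); rw [pow_succ]; linarith
      _ = 2 ^ (2 * b + 2) := by rw [← pow_mul]; congr 1; ring
      _ ≤ L ^ (2 * b + 2) := pow_le_pow_left₀ (by norm_num) hL _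
  calc 4 * N ^ 2 * L ^ (2 * k) ≤ L ^ (2 * b + 2) * L ^ (2 * k) :=
        mul_le_mul_of_nonneg_right h1 (by positivity)
    _ = L ^ (2 * b + 2 + 2 * k) := by rw [← pow_add]
    _ ≤ L ^ (10 * (t₀ + 1) + 2) := pow_le_pow_right₀ hL1 (by omega)

/-- … hence `4N²L^{2k}·(L^{10(t₀+1)+2})⁻¹ ≤ 1`. -/
theorem four_N_sq_pow_mul_inv_le_one {L N : ℝ} (hL : 2 ≤ L) (hN : 0 ≤ N) {b k t₀ : ℕ} (hNb : N ≤ 2 ^ b)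
    (ht : 2 * k + 2 * b ≤ 10 * (t₀ + 1)) :
    4 * N ^ 2 * L ^ (2 * k) * (L ^ (10 * (t₀ + 1) + 2))⁻¹ ≤ 1 := by
  have hL0 : 0 < L := by linarith
  rw [← div_eq_mul_inv, div_le_one (by positivity)]
  exact four_N_sq_pow_le hL hN hNb ht

/-- CHOICE OF THE WALK LENGTH `ℓ = 2j`: if `20N ≤ 2^j` then `20·N·ρ^{2j} ≤ (√2·ρ)^{2j}`, i.e. a trace bound
`tr(A^{2j}) < 20Nρ^{2j}` yields the cut-value bound with `r = √2·ρ`. -/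
theorem twenty_N_pow_le {N ρ : ℝ} (hρ : 0 ≤ ρ) {j : ℕ} (h : 20 * N ≤ 2 ^ j) :
    20 * N * ρ ^ (2 * j) ≤ (Real.sqrt 2 * ρ) ^ (2 * j) := by
  have h2 : (Real.sqrt 2 * ρ) ^ (2 * j) = 2 ^ j * ρ ^ (2 * j) := by
    rw [mul_pow, pow_mul, Real.sq_sqrt (by norm_num : (0 : ℝ) ≤ 2)]
  rw [h2]
  exact mul_le_mul_of_nonneg_right h (by positivity)

/-! ### The remainder budget -/

/-- `√2 ≤ 1.4143`. -/
theorem sqrt_two_le : Real.sqrt 2 ≤ 1.4143 := by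
  rw [Real.sqrt_le_left (by norm_num)]; norm_num

/-- REMAINDER BUDGET: with `ρ ≤ L/20`, `N ≤ 2n + 1 + 6m/L` pieces (block splitting of both sides of a 3-local
instance, `SfmBlBlockSplit.sum_blocks_le`), `L·n ≤ m` (the stretch `C = L`) and `n ≥ 1`:
`N·(√2·ρ)/2 ≤ 0.32·m`. -/
theorem remainder_budget_le {n m : ℕ} {L N ρ : ℝ} (hL : 0 < L) (hn : 1 ≤ n) (hC : L * n ≤ m)
    (hρ : ρ ≤ L / 20) (hN0 : 0 ≤ N) (hN : N ≤ 2 * n + 1 + 6 * m / L) :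
    N * (Real.sqrt 2 * ρ) / 2 ≤ 0.32 * m := by
  have hn' : (1 : ℝ) ≤ n := by exact_mod_cast hn
  have hNL : N * L ≤ 9 * m := by
    have h1 : N * L ≤ (2 * n + 1 + 6 * m / L) * L := mul_le_mul_of_nonneg_right hN hL.le
    have h2 : (2 * n + 1 + 6 * m / L) * L = (2 * n + 1) * L + 6 * m := by field_simp
    have h3 : (2 * (n : ℝ) + 1) * L ≤ 3 * (L * n) := by nlinarith
    linarith
  have hs := sqrt_two_le
  have hs0 : 0 ≤ Real.sqrt 2 := Real.sqrt_nonneg 2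
  calc N * (Real.sqrt 2 * ρ) / 2 ≤ N * (Real.sqrt 2 * (L / 20)) / 2 := by
        gcongr
    _ = Real.sqrt 2 * (N * L) / 40 := by ring
    _ ≤ 1.4143 * (9 * m) / 40 := by gcongr
    _ ≤ 0.32 * m := by
        have : (0 : ℝ) ≤ m := Nat.cast_nonneg m
        nlinarith

end Summit.PneNP.PneNP.Theorems.SfmBl
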